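import Summits.QuantumFields.YangMills.Theorems.BalabanUVNodesN14SizeBinder
import Summits.QuantumFields.BalabanUV.T4Continuum.Spine.NE1p.TiltedMeanCrossover

/-!
# BalabanUVNodes ∕ node N14 = NE1′ — THE DECL OF RECORD FEEDS THE ROW's RESIDUAL BINDER BY NAME: `DressedStabilityStrict 𝒯 Λ`
# (one tower, both runs) supplies the two ONE-RUN old-component budgets of `TiltedMeanCrossover`, hence `TiltedMeanMatching`
# with the SUMMABLE crossover majorant — modulo the scale ledger, the identification, and the two-run young rate

Cell `pub-ymgap`, HUMAN RULING D-0062 (Track A at full width), seat `pub-ymgap-dag-n14-a` (-a KNIT-BY-NAME), generation 2;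
route `Summits/QuantumFields/YangMills/Theses/BalabanUVNodes.lean` (item `SpineGivenEndpoint`); venue ruling R424.  THEOREMS ONLY;
imports this seat's module 4 `BalabanUVNodesN14SizeBinder` (through it modules 1 and the NE1′ owner lineage's `DressedRootStrict*`)
and the `pub-balaban-gaps` seat ne1's `Spine/NE1p/TiltedMeanCrossover` (p-id of record in `ne/NE1.md` §2; through it `DressedMGFForm`
p341456 — `tiltedMean`, `TiltedMeanMatching`, `core_of_mgfForm`, `hybridNE7_of_mgfForm` — and `Spine.NE7.QLa`, `T4Crossover`) ONLY;
modifies nothing; every cited lemma is used BY NAME.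

WHY THIS FILE.  The roster row of N14 (director-ym ROSTER-D0062, dag-lead NODE-TABLE row n14) names TWO decls: the statement of record
`NE1p.DressedRoot.DressedStabilityStrict 𝒯 Λ` (`Spine/NE1p/DressedRootStrict.lean` :58) AND the «residual» `NE1p.DressedMGFForm.TiltedMeanMatching`
(`DressedMGFForm.lean` :253) — «the ONE two-run binder the dressing leaves» on the MGF road into `T4MatchingAssembly.HybridNE7`
(`core_of_mgfForm` ∕ `hybridNE7_of_mgfForm`: the dressed runs' hybrid-NE7 datum ⇐ the undressed datum + MGF forms + `TiltedMeanMatching η`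
with `Summable η`).  Seat ne1 (gen 3) typed the residual's PRODUCER `TiltedMeanCrossover.tiltedMeanMatching_of_budget`: a `ScaleLedger`
(the two runs' tilted first moments decomposed over one slot ledger), two ONE-RUN `OldInfluenceBudget`s (= `Spine.NE7.QLa` on influence
data, letter `a < 1`) and a TWO-RUN `YoungInfluenceRate` (NE5∕NE9's currency) give `TiltedMeanMatching … (crossoverEta …)`, summable by
`summable_crossoverEta`.  Nobody had joined the two decls of the row: THIS file shows the DECL OF RECORD IS the producer's one-run input —
ONE `DressedStabilityStrict 𝒯 Λ` (both runs are parameters of the one dressed tower) gives BOTH old-component budgets with the letter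
`a = ρ·Λ < 1` = N14's strict product, hence `TiltedMeanMatching` with a SUMMABLE majorant, modulo the displayed binders that are other rows'
(the ledger and the young rate) or NODE O's (the identification of slots with booked births, influence ≤ booked size × volume weight).

* §1 GLUE [folklore]: `tiltedMeanMatching_mono` (the binder is monotone in `η`); `sum_min_pow_mono` ∕ `crossoverEta_mono` (the crossover
  majorant is monotone in the old-term letter `a ≥ 0`); `summable_crossoverEta_of_nonneg` (summability for `0 ≤ a < 1` — `a = 0` allowed —
  by domination with `a⁺ = max(a, 1∕2)` and ne1's `summable_crossoverEta`); `slice_abs_le_of_dom` (a slice's one-run influence sum from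
  per-slot domination `|Δ X| ≤ σ·wt X` and the census `Σ_{sc = j} wt ≤ M`).
* §2 ONE RUN.  **`oldInfluenceBudget_of_with`**: `DressedStabilityWith 𝒯 A₀ ρ₁ τ` + identification of every slot of scale `j` of the
  consumer's ledger `wf K τ` with a booked birth `β X` of the run's booking at `(p, K′)` (birth scale aligned: `K′ − j(β X) = K − sc X`) +
  domination `|Δ K t τ s X| ≤ size (β X) K′ · wt X` (`wt ≥ 0`) + the census `T4RecentScale.Multiplicity (wf K τ) (sc K) (wt K τ) Cw vol Λ K`
  ⇒ `OldInfluenceBudget l₀ T Bad wf sc Δ vol (A₀·Cw) ((ρ₁τ)·Λ)`; **`oldInfluenceBudget_of_n14`** — from the root of record: `∃ E a`,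
  `0 ≤ E`, `0 ≤ a`, **`a < 1`**, with the budget at `(E, a)` (`E = A₀Cw`, `a = ρ₁τΛ`).
* §3 TWO RUNS ⇒ THE RESIDUAL.  **`tiltedMeanMatching_of_with`** (displayed constants): ScaleLedger + N14 With-form serving BOTH runs'
  identifications + census at N14's rate `Λ` + young rate `(C, θ, Λ′)` ⇒ `TiltedMeanMatching l₀ T Bad F ν F′ ν′
  (crossoverEta vol (A₀Cw) (A₀Cw) C ((ρ₁τ)Λ) θ Λ′ w)` (`tiltedMeanMatching_of_budget` BY NAME); **`tiltedMeanMatching_of_n14`** — from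
  `DressedStabilityStrict 𝒯 Λ`: `∃ E a, 0 ≤ E ∧ 0 ≤ a ∧ a < 1 ∧ TiltedMeanMatching … (crossoverEta vol E E C a θ Λ′ w)`;
  **`tiltedMeanMatching_summable_of_n14`** — with `0 < θ < 1 ≤ …`, `θ ≤ Λ′`, `Summable w`, `vol, Cw ≥ 0`: `∃ η, TiltedMeanMatching … η ∧
  Summable η` — EXACTLY the pair `DressedMGFForm.hybridNE7_of_mgfForm` consumes (`hη`, `hηs`).
* §4 GUARD [decided toy]: on the owner's `toyTower` with one-point field spaces, Dirac laws, ONE slot of scale `0` whose run-B influence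
  IS the toy's booked final-scale size `(1∕4)^K` (run A's is `0`): the scale ledger, both identifications (run A at the owner's toy birth with
  ZERO influence, run B dominated WITH EQUALITY), the census at rate `2` and the young rate hold, and §3 returns
  `TiltedMeanMatching … (crossoverEta 1 (1·1) (1·1) 1 ((1∕4)·2) θ Λ′ 0)` — the binder list is jointly satisfiable, non-degenerately
  (`tiltedMeanMatching_toyTower`).

HONEST FRAMING.  Kernel bookkeeping BY NAME over hypothesis SHAPES and finite sums; 0 sorry; nothing of Bałaban's densities is asserted or
instantiated; `ScaleLedger` (which slot ledger realises the tilted first moments of Bałaban's runs), the identification∕domination of slot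
influences by booked sizes, the census and the young rate are DISPLAYED binders discharged by nobody (NODE O ∕ rows NE5–NE9 ∕ the record
predicate); NE1′ is NOT PRINTED ([Balaban1989LargeFieldII] (1.73)–(1.75) pp. 379–380 type the action only; p. 356 ll. 1–6) and NOT PROVED;
`TiltedMeanMatching` is NOT thereby instantiated; NE7 NOT proved; count-neutral (discharged count unmoved).  One finite four-torus at
fixed ε; NOT infinite volume, NOT OS on ℝ⁴, NOT a mass gap, NOT Clay.
-/

noncomputable section

namespace YMDAG.N14

open Finset MeasureTheory
open scoped BigOperators
open Literature.MathematicalPhysics.QuantumFieldTheory.Balaban1983to89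
open Literature.MathematicalPhysics.QuantumFieldTheory.Balaban1983to89.T4TermFormat
open Literature.MathematicalPhysics.QuantumFieldTheory.Balaban1983to89.T4RecentScale (Multiplicity)
open Summit.QuantumFields.BalabanUV.T4Continuum.NE1p.DressedRoot
open Summit.QuantumFields.BalabanUV.T4Continuum.NE1p.DressedRootStrictSeparation
open Summit.QuantumFields.BalabanUV.T4Continuum.NE1p.DressedMGFForm (tiltedMean TiltedMeanMatching)
open Summit.QuantumFields.BalabanUV.T4Continuum.NE1p.TiltedMeanCrossover

/-! ## §1 Glue: monotonicity of the binder and of the crossover majorant; summability for `0 ≤ a < 1`; one slice -/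

section Glue

variable {ι D : Type*} [DecidableEq ι] {Ω Ω' : ℕ → Type*} [∀ K, MeasurableSpace (Ω K)] [∀ K, MeasurableSpace (Ω' K)]
  {l₀ : ℝ} {T : ℕ → Finset ι} {Bad : ℕ → ℝ → Finset ι} {F : ∀ K, Ω K → ℝ} {ν : ∀ K, ι → Measure (Ω K)}
  {F' : ∀ K, Ω' K → ℝ} {ν' : ∀ K, ι → Measure (Ω' K)}

/-- **THE RESIDUAL BINDER IS MONOTONE IN ITS MAJORANT** [folklore]: `η ≤ η′` pointwise turns `TiltedMeanMatching … η` into `… η′`. -/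
theorem tiltedMeanMatching_mono {η η' : ℕ → ℝ} (h : TiltedMeanMatching l₀ T Bad F ν F' ν' η) (hle : ∀ K, η K ≤ η' K) :
    TiltedMeanMatching l₀ T Bad F ν F' ν' η' :=
  fun K t ht τ hτ s hs => (h K t ht τ hτ s hs).trans (hle K)

/-- The crossover sum is monotone in the old-term letter: `0 ≤ a ≤ a′` gives
`Σ_{j+n=K} min(a^n, θ^jΛ^n) ≤ Σ_{j+n=K} min(a′^n, θ^jΛ^n)`. [folklore] -/
theorem sum_min_pow_mono {a a' θ Λ : ℝ} (ha : 0 ≤ a) (hle : a ≤ a') (K : ℕ) :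
    ∑ p ∈ antidiagonal K, min (a ^ p.2) (θ ^ p.1 * Λ ^ p.2) ≤ ∑ p ∈ antidiagonal K, min (a' ^ p.2) (θ ^ p.1 * Λ ^ p.2) :=
  sum_le_sum fun q _ => min_le_min_right _ (pow_le_pow_left₀ ha hle q.2)

/-- **THE CROSSOVER MAJORANT IS MONOTONE IN THE OLD-TERM LETTER** [folklore]: for `vol ≥ 0`, `0 ≤ E_A + E_B` and `0 ≤ a ≤ a′`,
`crossoverEta vol E_A E_B C a θ Λ w K ≤ crossoverEta vol E_A E_B C a′ θ Λ w K`. -/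
theorem crossoverEta_mono {vol EA EB C a a' θ Λ : ℝ} {w : ℕ → ℝ} (hvol : 0 ≤ vol) (hE : 0 ≤ EA + EB) (ha : 0 ≤ a)
    (hle : a ≤ a') (K : ℕ) : crossoverEta vol EA EB C a θ Λ w K ≤ crossoverEta vol EA EB C a' θ Λ w K := by
  unfold crossoverEta
  exact add_le_add le_rfl (mul_le_mul_of_nonneg_left (sum_min_pow_mono ha hle K)
    (mul_nonneg hvol (hE.trans (le_max_left _ _))))

/-- **SUMMABILITY OF THE CROSSOVER MAJORANT FOR `0 ≤ a < 1`** [folklore] (`a = 0` allowed; ne1's `summable_crossoverEta` asks `0 < a`):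
with `0 < θ < 1`, `θ ≤ Λ`, `Summable w`, `vol ≥ 0`, `0 ≤ E_A + E_B`: `Summable (crossoverEta vol E_A E_B C a θ Λ w)` — the part above the
base widths is nonnegative and dominated by its value at `a⁺ = max(a, 1∕2) ∈ ]0, 1[`. -/
theorem summable_crossoverEta_of_nonneg {vol EA EB C a θ Λ : ℝ} {w : ℕ → ℝ} (hvol : 0 ≤ vol) (hE : 0 ≤ EA + EB)
    (ha : 0 ≤ a) (ha1 : a < 1) (hθ : 0 < θ) (hθ1 : θ < 1) (hθΛ : θ ≤ Λ) (hw : Summable w) :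
    Summable (crossoverEta vol EA EB C a θ Λ w) := by
  set a' : ℝ := max a (1 / 2) with ha'
  have ha'0 : 0 < a' := lt_of_lt_of_le (by norm_num) (le_max_right _ _)
  have ha'1 : a' < 1 := max_lt ha1 (by norm_num)
  have haa' : a ≤ a' := le_max_left _ _
  have hΛ : 0 ≤ Λ := hθ.le.trans hθΛ
  -- the part above the base widths, at `a` and at `a⁺`
  set g : ℕ → ℝ := fun K => vol * max (EA + EB) C * ∑ p ∈ antidiagonal K, min (a ^ p.2) (θ ^ p.1 * Λ ^ p.2) with hg
  set g' : ℕ → ℝ := fun K => vol * max (EA + EB) C * ∑ p ∈ antidiagonal K, min (a' ^ p.2) (θ ^ p.1 * Λ ^ p.2) with hg'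
  have hcoef : 0 ≤ vol * max (EA + EB) C := mul_nonneg hvol (hE.trans (le_max_left _ _))
  have hg0 : ∀ K, 0 ≤ g K := fun K =>
    mul_nonneg hcoef (sum_nonneg fun p _ => le_min (pow_nonneg ha _) (mul_nonneg (pow_nonneg hθ.le _) (pow_nonneg hΛ _)))
  have hgg' : ∀ K, g K ≤ g' K := fun K => mul_le_mul_of_nonneg_left (sum_min_pow_mono ha haa' K) hcoef
  have hs' : Summable g' := (T4Crossover.summable_sum_min_pow ha'0 ha'1 hθ hθ1 hθΛ).mul_left (vol * max (EA + EB) C)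
  have hs : Summable g := Summable.of_nonneg_of_le hg0 hgg' hs'
  have heq : crossoverEta vol EA EB C a θ Λ w = fun K => w K + g K := by
    funext K; simp only [crossoverEta, hg]
  rw [heq]
  exact hw.add hs

/-- **ONE SLICE** [folklore]: per-slot domination `|Δ X| ≤ σ·wt X` on the scale-`j` slice (`σ ≥ 0`) and the slice census
`Σ_{sc X = j} wt X ≤ M` give `Σ_{sc X = j} |Δ X − 0| ≤ σ·M`. -/
theorem slice_abs_le_of_dom (wf : Finset D) (sc : D → ℕ) (Δ wt : D → ℝ) (j : ℕ) {σ M : ℝ}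
    (hdom : ∀ X ∈ wf, sc X = j → |Δ X| ≤ σ * wt X) (hσ : 0 ≤ σ) (hM : ∑ X ∈ wf with sc X = j, wt X ≤ M) :
    ∑ X ∈ wf with sc X = j, |Δ X - 0| ≤ σ * M := by
  calc ∑ X ∈ wf with sc X = j, |Δ X - 0| ≤ ∑ X ∈ wf with sc X = j, σ * wt X :=
        sum_le_sum fun X hX => by
          obtain ⟨hXw, hXj⟩ := mem_filter.mp hX
          rw [sub_zero]; exact hdom X hXw hXj
    _ = σ * ∑ X ∈ wf with sc X = j, wt X := (mul_sum _ _ _).symm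
    _ ≤ σ * M := mul_le_mul_of_nonneg_left hM hσ

end Glue

/-! ## §2 One run: N14 ⇒ the old-component influence budget (`Spine.NE7.QLa` on influence data) with the letter `a = ρ₁τΛ` -/

section OneRun

variable {P : Type*} {𝒯 : DressedTower P} {ι D : Type*} [DecidableEq ι]

/-- **N14 WITH DISPLAYED CONSTANTS ⇒ ONE RUN's OLD-COMPONENT BUDGET** [bookkeeping].  Data: the consumer's classes `T`, bad classes
`Bad`, slot ledgers `wf K τ` with scales `sc K`, this run's slot influences `Δ K t τ s X` on its tilted first moment, volume weights
`wt K τ X ≥ 0`, census constants `Cw, vol`; IDENTIFICATION with the dressed tower: for every `(K, t, s)` a run parameter `p K t s` and a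
cutoff `K′ K`, and a birth map `β` into the booking `𝒯.B (p K t s) (K′ K)` with birth scales aligned (`K′ K − j(β X) = K − sc K X`) and
DOMINATION `|Δ K t τ s X| ≤ size (β X) (K′ K) · wt K τ X` (the influence of a dressed term on the tilted mean is at most its booked
final-scale size times its volume weight); CENSUS `Multiplicity (wf K τ) (sc K) (wt K τ) Cw vol Λ K` at rate `Λ`.  Then
`DressedStabilityWith 𝒯 A₀ ρ₁ τ` gives `OldInfluenceBudget l₀ T Bad wf sc Δ vol (A₀·Cw) ((ρ₁τ)·Λ)`.  [folklore] -/
theorem oldInfluenceBudget_of_with {A₀ ρ₁ τ : ℝ} (hW : DressedStabilityWith 𝒯 A₀ ρ₁ τ) (l₀ : ℝ) (T : ℕ → Finset ι)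
    (Bad : ℕ → ℝ → Finset ι) (wf : ℕ → ι → Finset D) (sc : ℕ → D → ℕ) (Δ : ℕ → ℝ → ι → ℝ → D → ℝ)
    (wt : ℕ → ι → D → ℝ) {Cw vol Λ : ℝ} (p : ℕ → ℝ → ℝ → P) (K' : ℕ → ℕ)
    (β : ∀ K (t : ℝ) (τ : ι) (s : ℝ), D → (𝒯.B (p K t s) (K' K)).Birth)
    (hsc : ∀ K t τ s, ∀ X ∈ wf K τ, K' K - (𝒯.B (p K t s) (K' K)).birthScale (β K t τ s X) = K - sc K X)
    (hdom : ∀ K (t : ℝ), |t| ≤ l₀ → ∀ τ ∈ T K \ Bad K t, ∀ s : ℝ, |s| ≤ l₀ → ∀ X ∈ wf K τ,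
      |Δ K t τ s X| ≤ (𝒯.B (p K t s) (K' K)).size (β K t τ s X) (K' K) * wt K τ X)
    (hwt : ∀ K τ, ∀ X ∈ wf K τ, 0 ≤ wt K τ X) (hM : ∀ K, ∀ τ ∈ T K, Multiplicity (wf K τ) (sc K) (wt K τ) Cw vol Λ K) :
    OldInfluenceBudget l₀ T Bad wf sc Δ vol (A₀ * Cw) ((ρ₁ * τ) * Λ) := by
  intro K t ht c hc s hs j hj
  have hcT : c ∈ T K := (mem_sdiff.mp hc).1
  have hA₀ : 0 ≤ A₀ := hW.1
  have hρ : 0 ≤ ρ₁ * τ := mul_nonneg hW.2.1 hW.2.2.1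
  have hσ : 0 ≤ A₀ * (ρ₁ * τ) ^ (K - j) := mul_nonneg hA₀ (pow_nonneg hρ _)
  have hdom' : ∀ X ∈ wf K c, sc K X = j → |Δ K t c s X| ≤ A₀ * (ρ₁ * τ) ^ (K - j) * wt K c X := by
    intro X hX hXj
    refine (hdom K t ht c hc s hs X hX).trans (mul_le_mul_of_nonneg_right ?_ (hwt K c X hX))
    rw [← hXj, ← hsc K t c s X hX]
    exact size_final_le_of_with hW (p K t s) (K' K) (β K t c s X)
  calc ∑ X ∈ wf K c with sc K X = j, |Δ K t c s X - (fun _ => (0 : ℝ)) X|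
      ≤ A₀ * (ρ₁ * τ) ^ (K - j) * (Cw * vol * Λ ^ (K - j)) :=
        slice_abs_le_of_dom (wf K c) (sc K) (Δ K t c s) (wt K c) j hdom' hσ (hM K c hcT j hj)
    _ = vol * (A₀ * Cw * ((ρ₁ * τ) * Λ) ^ (K - j)) := by rw [mul_pow]; ring

/-- **N14's ROOT OF RECORD ⇒ ONE RUN's OLD-COMPONENT BUDGET, WITH THE LETTER** [bookkeeping]: from `DressedStabilityStrict 𝒯 Λ` and the
identification∕domination∕census of `oldInfluenceBudget_of_with` (census AT N14's RATE `Λ`): `∃ E a, 0 ≤ E ∧ 0 ≤ a ∧ a < 1 ∧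
OldInfluenceBudget l₀ T Bad wf sc Δ vol E a` (`E = A₀Cw` for `Cw ≥ 0`, `a = ρ₁τΛ` — N14's strict product IS the budget's letter). [folklore] -/
theorem oldInfluenceBudget_of_n14 {Λ : ℝ} (h : DressedStabilityStrict 𝒯 Λ) (l₀ : ℝ) (T : ℕ → Finset ι)
    (Bad : ℕ → ℝ → Finset ι) (wf : ℕ → ι → Finset D) (sc : ℕ → D → ℕ) (Δ : ℕ → ℝ → ι → ℝ → D → ℝ)
    (wt : ℕ → ι → D → ℝ) {Cw vol : ℝ} (hCw : 0 ≤ Cw) (p : ℕ → ℝ → ℝ → P) (K' : ℕ → ℕ)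
    (β : ∀ K (t : ℝ) (τ : ι) (s : ℝ), D → (𝒯.B (p K t s) (K' K)).Birth)
    (hsc : ∀ K t τ s, ∀ X ∈ wf K τ, K' K - (𝒯.B (p K t s) (K' K)).birthScale (β K t τ s X) = K - sc K X)
    (hdom : ∀ K (t : ℝ), |t| ≤ l₀ → ∀ τ ∈ T K \ Bad K t, ∀ s : ℝ, |s| ≤ l₀ → ∀ X ∈ wf K τ,
      |Δ K t τ s X| ≤ (𝒯.B (p K t s) (K' K)).size (β K t τ s X) (K' K) * wt K τ X)
    (hwt : ∀ K τ, ∀ X ∈ wf K τ, 0 ≤ wt K τ X) (hM : ∀ K, ∀ τ ∈ T K, Multiplicity (wf K τ) (sc K) (wt K τ) Cw vol Λ K) :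
    ∃ E a : ℝ, 0 ≤ E ∧ 0 ≤ a ∧ a < 1 ∧ OldInfluenceBudget l₀ T Bad wf sc Δ vol E a := by
  obtain ⟨A₀, ρ₁, τ, hW, hΛ, h1⟩ := dressedStabilityStrict_iff_lt_one.mp h
  refine ⟨A₀ * Cw, ρ₁ * τ * Λ, mul_nonneg hW.1 hCw, mul_nonneg (mul_nonneg hW.2.1 hW.2.2.1) hΛ, ?_,
    oldInfluenceBudget_of_with hW l₀ T Bad wf sc Δ wt p K' β hsc hdom hwt hM⟩
  calc ρ₁ * τ * Λ = Λ * ρ₁ * τ := by ring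
    _ < 1 := h1

end OneRun

/-! ## §3 Two runs of ONE tower: N14 ⇒ `TiltedMeanMatching` with the (summable) crossover majorant -/

section TwoRuns

variable {P : Type*} {𝒯 : DressedTower P} {ι D : Type*} [DecidableEq ι] {Ω Ω' : ℕ → Type*} [∀ K, MeasurableSpace (Ω K)]
  [∀ K, MeasurableSpace (Ω' K)] {l₀ vol : ℝ} {T : ℕ → Finset ι} {Bad : ℕ → ℝ → Finset ι} {F : ∀ K, Ω K → ℝ}
  {ν : ∀ K, ι → Measure (Ω K)} {F' : ∀ K, Ω' K → ℝ} {ν' : ∀ K, ι → Measure (Ω' K)} {wf : ℕ → ι → Finset D}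
  {sc : ℕ → D → ℕ} {bA bB : ℕ → ℝ → ι → ℝ → ℝ} {ΔA ΔB : ℕ → ℝ → ι → ℝ → D → ℝ} {w : ℕ → ℝ}

/-- **N14 WITH DISPLAYED CONSTANTS ⇒ THE RESIDUAL BINDER** [bookkeeping]: a `ScaleLedger` for the two runs' tilted first moments (base
widths `w`), ONE `DressedStabilityWith 𝒯 A₀ ρ₁ τ` serving BOTH runs' identifications∕dominations (run A: parameters `pA`, cutoffs `KA`,
births `βA`; run B: `pB`, `KB`, `βB` — two parameters of the one dressed tower), the census of the common ledger at rate `Λ`, and the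
two-run `YoungInfluenceRate … C θ Λ′` give
`TiltedMeanMatching l₀ T Bad F ν F′ ν′ (crossoverEta vol (A₀Cw) (A₀Cw) C ((ρ₁τ)Λ) θ Λ′ w)` — ne1's `tiltedMeanMatching_of_budget` on §2's
two budgets.  (`vol, Λ, θ, Λ′ ≥ 0`.) [folklore] -/
theorem tiltedMeanMatching_of_with {A₀ ρ₁ τ Cw Λ C θ Λ' : ℝ} (hW : DressedStabilityWith 𝒯 A₀ ρ₁ τ)
    (hL : ScaleLedger l₀ T Bad F ν F' ν' wf sc bA bB ΔA ΔB w) (wt : ℕ → ι → D → ℝ)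
    (hwt : ∀ K τ, ∀ X ∈ wf K τ, 0 ≤ wt K τ X) (hM : ∀ K, ∀ τ ∈ T K, Multiplicity (wf K τ) (sc K) (wt K τ) Cw vol Λ K)
    (pA : ℕ → ℝ → ℝ → P) (KA : ℕ → ℕ) (βA : ∀ K (t : ℝ) (τ : ι) (s : ℝ), D → (𝒯.B (pA K t s) (KA K)).Birth)
    (hscA : ∀ K t τ s, ∀ X ∈ wf K τ, KA K - (𝒯.B (pA K t s) (KA K)).birthScale (βA K t τ s X) = K - sc K X)
    (hdomA : ∀ K (t : ℝ), |t| ≤ l₀ → ∀ τ ∈ T K \ Bad K t, ∀ s : ℝ, |s| ≤ l₀ → ∀ X ∈ wf K τ,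
      |ΔA K t τ s X| ≤ (𝒯.B (pA K t s) (KA K)).size (βA K t τ s X) (KA K) * wt K τ X)
    (pB : ℕ → ℝ → ℝ → P) (KB : ℕ → ℕ) (βB : ∀ K (t : ℝ) (τ : ι) (s : ℝ), D → (𝒯.B (pB K t s) (KB K)).Birth)
    (hscB : ∀ K t τ s, ∀ X ∈ wf K τ, KB K - (𝒯.B (pB K t s) (KB K)).birthScale (βB K t τ s X) = K - sc K X)
    (hdomB : ∀ K (t : ℝ), |t| ≤ l₀ → ∀ τ ∈ T K \ Bad K t, ∀ s : ℝ, |s| ≤ l₀ → ∀ X ∈ wf K τ,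
      |ΔB K t τ s X| ≤ (𝒯.B (pB K t s) (KB K)).size (βB K t τ s X) (KB K) * wt K τ X)
    (hY : YoungInfluenceRate l₀ T Bad wf sc ΔA ΔB vol C θ Λ') (hvol : 0 ≤ vol) (hΛ : 0 ≤ Λ) (hθ : 0 ≤ θ) (hΛ' : 0 ≤ Λ') :
    TiltedMeanMatching l₀ T Bad F ν F' ν' (crossoverEta vol (A₀ * Cw) (A₀ * Cw) C ((ρ₁ * τ) * Λ) θ Λ' w) :=
  tiltedMeanMatching_of_budget hL (oldInfluenceBudget_of_with hW l₀ T Bad wf sc ΔA wt pA KA βA hscA hdomA hwt hM)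
    (oldInfluenceBudget_of_with hW l₀ T Bad wf sc ΔB wt pB KB βB hscB hdomB hwt hM) hY hvol
    (mul_nonneg (mul_nonneg hW.2.1 hW.2.2.1) hΛ) hθ hΛ'

/-- **N14's ROOT OF RECORD ⇒ THE RESIDUAL BINDER, LETTER `a < 1`** [bookkeeping]: from `DressedStabilityStrict 𝒯 Λ` (census at N14's
rate `Λ`, `Cw ≥ 0`) and the binders of `tiltedMeanMatching_of_with`:
`∃ E a, 0 ≤ E ∧ 0 ≤ a ∧ a < 1 ∧ TiltedMeanMatching l₀ T Bad F ν F′ ν′ (crossoverEta vol E E C a θ Λ′ w)`. [folklore] -/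
theorem tiltedMeanMatching_of_n14 {Λ Cw C θ Λ' : ℝ} (h : DressedStabilityStrict 𝒯 Λ)
    (hL : ScaleLedger l₀ T Bad F ν F' ν' wf sc bA bB ΔA ΔB w) (wt : ℕ → ι → D → ℝ)
    (hwt : ∀ K τ, ∀ X ∈ wf K τ, 0 ≤ wt K τ X) (hM : ∀ K, ∀ τ ∈ T K, Multiplicity (wf K τ) (sc K) (wt K τ) Cw vol Λ K)
    (hCw : 0 ≤ Cw)
    (pA : ℕ → ℝ → ℝ → P) (KA : ℕ → ℕ) (βA : ∀ K (t : ℝ) (τ : ι) (s : ℝ), D → (𝒯.B (pA K t s) (KA K)).Birth)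
    (hscA : ∀ K t τ s, ∀ X ∈ wf K τ, KA K - (𝒯.B (pA K t s) (KA K)).birthScale (βA K t τ s X) = K - sc K X)
    (hdomA : ∀ K (t : ℝ), |t| ≤ l₀ → ∀ τ ∈ T K \ Bad K t, ∀ s : ℝ, |s| ≤ l₀ → ∀ X ∈ wf K τ,
      |ΔA K t τ s X| ≤ (𝒯.B (pA K t s) (KA K)).size (βA K t τ s X) (KA K) * wt K τ X)
    (pB : ℕ → ℝ → ℝ → P) (KB : ℕ → ℕ) (βB : ∀ K (t : ℝ) (τ : ι) (s : ℝ), D → (𝒯.B (pB K t s) (KB K)).Birth)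
    (hscB : ∀ K t τ s, ∀ X ∈ wf K τ, KB K - (𝒯.B (pB K t s) (KB K)).birthScale (βB K t τ s X) = K - sc K X)
    (hdomB : ∀ K (t : ℝ), |t| ≤ l₀ → ∀ τ ∈ T K \ Bad K t, ∀ s : ℝ, |s| ≤ l₀ → ∀ X ∈ wf K τ,
      |ΔB K t τ s X| ≤ (𝒯.B (pB K t s) (KB K)).size (βB K t τ s X) (KB K) * wt K τ X)
    (hY : YoungInfluenceRate l₀ T Bad wf sc ΔA ΔB vol C θ Λ') (hvol : 0 ≤ vol) (hθ : 0 ≤ θ) (hΛ' : 0 ≤ Λ') :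
    ∃ E a : ℝ, 0 ≤ E ∧ 0 ≤ a ∧ a < 1 ∧ TiltedMeanMatching l₀ T Bad F ν F' ν' (crossoverEta vol E E C a θ Λ' w) := by
  obtain ⟨A₀, ρ₁, τ, hW, hΛ, h1⟩ := dressedStabilityStrict_iff_lt_one.mp h
  refine ⟨A₀ * Cw, ρ₁ * τ * Λ, mul_nonneg hW.1 hCw, mul_nonneg (mul_nonneg hW.2.1 hW.2.2.1) hΛ, ?_,
    tiltedMeanMatching_of_with hW hL wt hwt hM pA KA βA hscA hdomA pB KB βB hscB hdomB hY hvol hΛ hθ hΛ'⟩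
  calc ρ₁ * τ * Λ = Λ * ρ₁ * τ := by ring
    _ < 1 := h1

/-- **N14's ROOT OF RECORD ⇒ THE RESIDUAL BINDER WITH A SUMMABLE MAJORANT** [bookkeeping] — EXACTLY the pair
`DressedMGFForm.hybridNE7_of_mgfForm` consumes (`hη`, `hηs`): under the binders of `tiltedMeanMatching_of_n14` and the young rate's
summability letters `0 < θ < 1`, `θ ≤ Λ′`, base widths `Summable w`:
`∃ η, TiltedMeanMatching l₀ T Bad F ν F′ ν′ η ∧ Summable η` (`η = crossoverEta …` at N14's letter; §1's
`summable_crossoverEta_of_nonneg`). [folklore] -/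
theorem tiltedMeanMatching_summable_of_n14 {Λ Cw C θ Λ' : ℝ} (h : DressedStabilityStrict 𝒯 Λ)
    (hL : ScaleLedger l₀ T Bad F ν F' ν' wf sc bA bB ΔA ΔB w) (wt : ℕ → ι → D → ℝ)
    (hwt : ∀ K τ, ∀ X ∈ wf K τ, 0 ≤ wt K τ X) (hM : ∀ K, ∀ τ ∈ T K, Multiplicity (wf K τ) (sc K) (wt K τ) Cw vol Λ K)
    (hCw : 0 ≤ Cw)
    (pA : ℕ → ℝ → ℝ → P) (KA : ℕ → ℕ) (βA : ∀ K (t : ℝ) (τ : ι) (s : ℝ), D → (𝒯.B (pA K t s) (KA K)).Birth)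
    (hscA : ∀ K t τ s, ∀ X ∈ wf K τ, KA K - (𝒯.B (pA K t s) (KA K)).birthScale (βA K t τ s X) = K - sc K X)
    (hdomA : ∀ K (t : ℝ), |t| ≤ l₀ → ∀ τ ∈ T K \ Bad K t, ∀ s : ℝ, |s| ≤ l₀ → ∀ X ∈ wf K τ,
      |ΔA K t τ s X| ≤ (𝒯.B (pA K t s) (KA K)).size (βA K t τ s X) (KA K) * wt K τ X)
    (pB : ℕ → ℝ → ℝ → P) (KB : ℕ → ℕ) (βB : ∀ K (t : ℝ) (τ : ι) (s : ℝ), D → (𝒯.B (pB K t s) (KB K)).Birth)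
    (hscB : ∀ K t τ s, ∀ X ∈ wf K τ, KB K - (𝒯.B (pB K t s) (KB K)).birthScale (βB K t τ s X) = K - sc K X)
    (hdomB : ∀ K (t : ℝ), |t| ≤ l₀ → ∀ τ ∈ T K \ Bad K t, ∀ s : ℝ, |s| ≤ l₀ → ∀ X ∈ wf K τ,
      |ΔB K t τ s X| ≤ (𝒯.B (pB K t s) (KB K)).size (βB K t τ s X) (KB K) * wt K τ X)
    (hY : YoungInfluenceRate l₀ T Bad wf sc ΔA ΔB vol C θ Λ') (hvol : 0 ≤ vol) (hθ : 0 < θ) (hθ1 : θ < 1) (hθΛ' : θ ≤ Λ')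
    (hws : Summable w) :
    ∃ η : ℕ → ℝ, TiltedMeanMatching l₀ T Bad F ν F' ν' η ∧ Summable η := by
  obtain ⟨E, a, hE, ha, ha1, hTM⟩ := tiltedMeanMatching_of_n14 h hL wt hwt hM hCw pA KA βA hscA hdomA pB KB βB hscB hdomB hY
    hvol hθ.le (hθ.le.trans hθΛ')
  exact ⟨_, hTM, summable_crossoverEta_of_nonneg hvol (add_nonneg hE hE) ha ha1 hθ hθ1 hθΛ' hws⟩

end TwoRuns

/-! ## §4 Guard: the binder list of §3 is jointly satisfiable on the owner's toy tower, non-degenerately -/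

section Toy

/-- **§3 FIRES ON THE OWNER's TOY TOWER** [decided toy]: one-point field spaces with Dirac laws, ONE class, ONE slot of scale `0`;
run A's tilted first moments are `0` (observable `0`; influence `0`, dominated by the toy's positive booked size trivially), run B's are
the toy tower's own booked final-scale size `(1∕4)^K` (a constant observable), booked as THE INFLUENCE of the one slot — dominated by the
booked size WITH EQUALITY (volume weight `1`); both slots identified with the toy's one birth (scale `0`) at cutoff `K`; the census holds
at the toy's count rate `Λ = 2` with `Cw = vol = 1`; the young rate holds with `C = 1`, `θ ≥ 0` and any `Λ′ ≥ 1∕4`.  §3 then returns the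
(true, non-trivial) matching `|(1∕4)^K − 0| ≤ crossoverEta 1 (1·1) (1·1) 1 ((1∕2·1∕2)·2) θ Λ′ 0 K` — with the With-constants
`(A₀, ρ₁, τ) = (1, 1∕2, 1∕2)` of the owner's `toyConstants` read through END-B.  Nothing of Bałaban's is modelled. [folklore] -/
theorem tiltedMeanMatching_toyTower {θ Λ' : ℝ} (hθ : 0 ≤ θ) (hΛ' : (1 / 4 : ℝ) ≤ Λ') :
    TiltedMeanMatching (ι := Unit) (Ω := fun _ => Unit) (Ω' := fun _ => Unit) 1 (fun _ => {()}) (fun _ _ => ∅)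
      (fun (_ : ℕ) (_ : Unit) => (0 : ℝ)) (fun _ _ => Measure.dirac ())
      (fun (K : ℕ) (_ : Unit) => (toyBooking K).size () K) (fun _ _ => Measure.dirac ())
      (crossoverEta 1 (1 * 1) (1 * 1) 1 (((1 / 2 : ℝ) * (1 / 2)) * 2) θ Λ' (fun _ => 0)) := by
  have hW : DressedStabilityWith toyTower 1 (1 / 2) (1 / 2) :=
    dressedStabilityWith_of_bookingLeaves toyConstants toyTower fun _ K => toyLeaves K
  have hΛ'0 : 0 ≤ Λ' := le_trans (by norm_num) hΛ'
  refine tiltedMeanMatching_of_with (D := Unit) (wf := fun _ _ => {()}) (sc := fun _ _ => 0)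
    (bA := fun _ _ _ _ => 0) (bB := fun _ _ _ _ => 0) (ΔA := fun _ _ _ _ _ => 0)
    (ΔB := fun K _ _ _ _ => (toyBooking K).size () K) (Cw := 1) (C := 1) hW ?_ (fun _ _ _ => 1) (fun _ _ _ _ => zero_le_one) ?_
    (fun _ _ _ => ()) (fun K => K) (fun _ _ _ _ _ => ()) (fun _ _ _ _ _ _ => rfl) ?_
    (fun _ _ _ => ()) (fun K => K) (fun _ _ _ _ _ => ()) (fun _ _ _ _ _ _ => rfl) ?_ ?_ zero_le_one (by norm_num) hθ hΛ'0
  · -- the scale ledger: both tilted means are base `0` + the one slot's influence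
    intro K t _ τ _ s _
    refine ⟨fun _ _ => Nat.zero_le K, ?_, ?_, by simp⟩
    · rw [tiltedMean_const_dirac]; simp
    · rw [tiltedMean_const_dirac]; simp
  · -- the census at the toy's count rate `2`: one slot of weight `1` at scale `0`
    intro K τ _ j _
    calc ∑ X ∈ ({()} : Finset Unit) with (0 : ℕ) = j, (1 : ℝ) ≤ ∑ X ∈ ({()} : Finset Unit), (1 : ℝ) :=
          sum_le_sum_of_subset_of_nonneg (filter_subset _ _) fun _ _ _ => zero_le_one
      _ = 1 := by simp
      _ ≤ 1 * 1 * 2 ^ (K - j) := by rw [one_mul, one_mul]; exact one_le_pow₀ (by norm_num)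
  · -- run A's influences vanish: dominated by the (nonnegative) booked size
    intro K t _ τ _ s _ X _
    rw [abs_zero, mul_one]; exact (toyBooking K).size_nonneg () K
  · -- run B's influence IS the booked final-scale size: dominated with equality
    intro K t _ τ _ s _ X _
    rw [mul_one, abs_of_nonneg ((toyBooking K).size_nonneg () K)]
    exact le_rfl
  · -- the young rate with `C = 1`: `(1/4)^K ≤ 1·(1·(θ^0·Λ′^K))` at the one slot of scale `0`
    intro K t _ τ _ s _ j _
    have hsize : (toyBooking K).size () K = (1 / 4 : ℝ) ^ K := by
      show (1 / 2 : ℝ) ^ K * (1 / 2 : ℝ) ^ K = (1 / 4 : ℝ) ^ K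
      rw [← mul_pow]; norm_num
    by_cases hj : j = 0
    · subst hj
      rw [Finset.sum_filter, sum_singleton, if_pos rfl]
      show |(toyBooking K).size () K - 0| ≤ 1 * (1 * (θ ^ 0 * Λ' ^ (K - 0)))
      rw [sub_zero, hsize, abs_of_nonneg (by positivity), pow_zero, one_mul, one_mul, one_mul, Nat.sub_zero]
      exact pow_le_pow_left₀ (by norm_num) hΛ' K
    · have hf : (({()} : Finset Unit).filter fun _ => (0 : ℕ) = j) = ∅ :=
        Finset.filter_eq_empty_iff.mpr fun _ _ h => hj h.symm
      rw [hf, sum_empty]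
      positivity

end Toy

/-! ## §5 (v1.1) THE MGF ROAD END TO END: the DRESSED hybrid-NE7 datum from the UNDRESSED one and N14 -/

section Hybrid

variable {P : Type*} {𝒯 : DressedTower P} {ι D : Type*} [DecidableEq ι] {Ω Ω' : ℕ → Type*} [∀ K, MeasurableSpace (Ω K)]
  [∀ K, MeasurableSpace (Ω' K)] {l₀ vol : ℝ} {T : ℕ → Finset ι} {Bad : ℕ → ℝ → Finset ι} {F : ∀ K, Ω K → ℝ}
  {ν νsh : ∀ K, ι → Measure (Ω K)} {F' : ∀ K, Ω' K → ℝ} {ν' νsh' : ∀ K, ι → Measure (Ω' K)} {wf : ℕ → ι → Finset D}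
  {sc : ℕ → D → ℕ} {bA bB : ℕ → ℝ → ι → ℝ → ℝ} {ΔA ΔB : ℕ → ℝ → ι → ℝ → D → ℝ} {w : ℕ → ℝ}

open Summit.QuantumFields.BalabanUV.T4Continuum.NE1p.DressedMGFForm (MGFForm hybridNE7_of_mgfForm)
open Literature.MathematicalPhysics.QuantumFieldTheory.Balaban1983to89.T4MatchingAssembly (HybridNE7)

/-- **HOW N14 ENTERS THE SPINE ON THE MGF ROAD, IN ONE THEOREM** [bookkeeping]: the `T4MatchingAssembly.HybridNE7` datum of the
UNDRESSED runs (the `t = 0` families — what rows NE7 ∕ NE7b ∕ NE7c produce without the observable), MGF forms of both runs' dressed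
families and of their shell parts over sub-measures (seat ne1 gen 2: every dressed term total is the MGF of ONE variable bounded by `Bo`
under a finite history-conditioned measure), the gen-0 room `e^{2l₀Bo}(W₀ + Wsh₀) < 1`, AND N14's root of record
`DressedStabilityStrict 𝒯 Λ` serving both runs through §3's binders ON THE SHELL-FREE MEASURES `ν − νsh`, `ν′ − νsh′` (scale ledger,
identification∕domination, census at N14's rate, young rate with `0 < θ < 1`, `θ ≤ Λ′`, summable base widths) ⇒ the DRESSED runs
carry a hybrid-NE7 datum: weights `× e^{2l₀Bo}`, the same bad classes, remainders `δ K + (l₀∕vol)·η K` with `Summable η` —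
`DressedMGFForm.hybridNE7_of_mgfForm` fed by `tiltedMeanMatching_summable_of_n14`.  Every binder displayed; nothing instantiated. [folklore] -/
theorem hybridNE7_dressed_of_n14 {Bo Λ Cw C θ Λ' : ℝ} {A Bf shA shB : ℕ → ℝ → ι → ℝ} {W₀ Wsh₀ δ : ℕ → ℝ}
    (hvol : 0 < vol) (hl₀ : 0 ≤ l₀)
    (hA : MGFForm Bo T F ν A) (hB : MGFForm Bo T F' ν' Bf) (hshA : MGFForm Bo T F νsh shA) (hshB : MGFForm Bo T F' νsh' shB)
    (hleA : ∀ K, ∀ τ ∈ T K, νsh K τ ≤ ν K τ) (hleB : ∀ K, ∀ τ ∈ T K, νsh' K τ ≤ ν' K τ)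
    (h₀ : HybridNE7 l₀ vol T (fun K _ τ => A K 0 τ) (fun K _ τ => Bf K 0 τ) Bad W₀ (fun K _ τ => shA K 0 τ)
      (fun K _ τ => shB K 0 τ) Wsh₀ δ)
    (hroom : ∀ K, Real.exp (2 * l₀ * Bo) * (W₀ K + Wsh₀ K) < 1)
    (h : DressedStabilityStrict 𝒯 Λ)
    (hL : ScaleLedger l₀ T Bad F (fun K τ => ν K τ - νsh K τ) F' (fun K τ => ν' K τ - νsh' K τ) wf sc bA bB ΔA ΔB w)
    (wt : ℕ → ι → D → ℝ) (hwt : ∀ K τ, ∀ X ∈ wf K τ, 0 ≤ wt K τ X)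
    (hM : ∀ K, ∀ τ ∈ T K, Multiplicity (wf K τ) (sc K) (wt K τ) Cw vol Λ K) (hCw : 0 ≤ Cw)
    (pA : ℕ → ℝ → ℝ → P) (KA : ℕ → ℕ) (βA : ∀ K (t : ℝ) (τ : ι) (s : ℝ), D → (𝒯.B (pA K t s) (KA K)).Birth)
    (hscA : ∀ K t τ s, ∀ X ∈ wf K τ, KA K - (𝒯.B (pA K t s) (KA K)).birthScale (βA K t τ s X) = K - sc K X)
    (hdomA : ∀ K (t : ℝ), |t| ≤ l₀ → ∀ τ ∈ T K \ Bad K t, ∀ s : ℝ, |s| ≤ l₀ → ∀ X ∈ wf K τ,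
      |ΔA K t τ s X| ≤ (𝒯.B (pA K t s) (KA K)).size (βA K t τ s X) (KA K) * wt K τ X)
    (pB : ℕ → ℝ → ℝ → P) (KB : ℕ → ℕ) (βB : ∀ K (t : ℝ) (τ : ι) (s : ℝ), D → (𝒯.B (pB K t s) (KB K)).Birth)
    (hscB : ∀ K t τ s, ∀ X ∈ wf K τ, KB K - (𝒯.B (pB K t s) (KB K)).birthScale (βB K t τ s X) = K - sc K X)
    (hdomB : ∀ K (t : ℝ), |t| ≤ l₀ → ∀ τ ∈ T K \ Bad K t, ∀ s : ℝ, |s| ≤ l₀ → ∀ X ∈ wf K τ,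
      |ΔB K t τ s X| ≤ (𝒯.B (pB K t s) (KB K)).size (βB K t τ s X) (KB K) * wt K τ X)
    (hY : YoungInfluenceRate l₀ T Bad wf sc ΔA ΔB vol C θ Λ') (hθ : 0 < θ) (hθ1 : θ < 1) (hθΛ' : θ ≤ Λ') (hws : Summable w) :
    ∃ η : ℕ → ℝ, Summable η ∧
      HybridNE7 l₀ vol T A Bf Bad (fun K => Real.exp (2 * l₀ * Bo) * W₀ K) shA shB
        (fun K => Real.exp (2 * l₀ * Bo) * Wsh₀ K) (fun K => δ K + l₀ / vol * η K) := by
  obtain ⟨η, hTM, hηs⟩ := tiltedMeanMatching_summable_of_n14 h hL wt hwt hM hCw pA KA βA hscA hdomA pB KB βB hscB hdomB hY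
    hvol.le hθ hθ1 hθΛ' hws
  exact ⟨η, hηs, hybridNE7_of_mgfForm hvol hl₀ hA hB hshA hshB hleA hleB h₀ hroom hTM hηs⟩

end Hybrid

end YMDAG.N14

end
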